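import Summits.BirchSwinnertonDyer.Uniform.U2.TransportAOddTrace
import HarnessLib

/-!
# Track U2, route A (cell `bsd-uniform`, seat u2-p1): route A under Mazur–Rubin's PLACE-WISE
# criteria (Lemma 2.10 (i)–(v) at every place) — `d ≡ 5 (mod 8)` admitted for bases good at `2`,
# and non-split bad odd primes admitted whenever `E(ℚ_ℓ)[2] = 0`

HONEST FRAMING (cell `bsd-uniform`, HOME run/shared/lean/pub/bsd-uniform/, verbatim in every file of
the seat): a RELATIVE ("twist-transport") theorem, uniform in the twisting parameter `d`, CONDITIONAL
per base curve on named invariants of the base (`E(ℚ)[2] = 0`, `Ш(E/ℚ)[2] = 0`, `rank E(ℚ) ≤ 1`) and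
on ONE input about the twist (`Ш(E^{(d)}/ℚ)[2^∞]` finite, or `r_an(E^{(d)}) ≤ 1`); converts PAIRS,
never the class X5; books nothing; moves no census number; no per-curve certificate is counted as a
uniform theorem. The ONLY difference from `TransportAExplicit` / `TransportAOddTrace` is the control
input: instead of Mazur–Rubin's numbered Cor. 3.4 (ii) (`MazurRubin2010.cor34ii_rat`, whose Prop. 3.3
list demands «all primes above 2 split», i.e. `d ≡ 1 (mod 8)` over `ℚ` — residue R-A3 — and «all
additive primes / even-`ord` multiplicative primes split» — residues R-A1/R-A2) it takes the
place-wise mechanism Mazur–Rubin print and prove but do not number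
(`MazurRubin2010.d2_eq_of_lemma210_rat`: Lemma 2.10 (i)–(v) at every place + Def. 2.3, the first
display of the proof of Prop. 3.3 with `T = ∅`; HOME/u2/INGREDIENTS.md §9 reads it as TYPABLE; it is a
NAMED FACT taken as a hypothesis, exactly like `cor34ii_rat`). §1 proves that the numbered corollary
IS the special case (`cor34ii_rat_of_d2_eq_of_lemma210_rat`), so nothing consumed before is lost.
WHAT THE PLACE-WISE FORM BUYS (all three are Lemma 2.10 disjuncts, verbatim): at `2`, «(v) good
reduction and unramified» — so for bases GOOD at `2` every odd `d` is admissible (`d ≡ 5 (mod 8)`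
included: R-A3 removed for them), and «(iii)» admits odd-`ord₂ Δ` multiplicative bases likewise; at an
odd bad prime `ℓ ∤ d` that does NOT split in `ℚ(√d)`, «(ii) `ℓ ∤ 2∞` and `E(ℚ_ℓ)[2] = 0`» suffices
(R-A1/R-A2 shrink to the non-split bad odd primes with `E(ℚ_ℓ)[2] ≠ 0`). RESIDUE after this file
(HOME/RESIDUE.md, route A rows): R-A1′ additive odd `ℓ`, non-split, `E(ℚ_ℓ)[2] ≠ 0`; R-A2′
multiplicative even-`ord` odd `ℓ`, non-split, `E(ℚ_ℓ)[2] ≠ 0` (genuine: `δ_ℓ` may be `1`); R-A3′ bases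
BAD at `2` other than odd-`ord` multiplicative, with `d ≡ 5 (mod 8)` (Lemma 2.10 (ii) excludes
`v ∣ 2`); R-A4 `Δ > 0 ∧ d < 0`; R-A5/6/7 unchanged.

## Contents
* `cor34ii_rat_of_d2_eq_of_lemma210_rat` — the numbered Cor. 3.4 (ii) (+ Prop. 3.3) is the special
  case of the place-wise form (consistency of the two typed facts; bookkeeping).
* `routeA_placewise` — rank and `Ш[2^∞]` transport under the place-wise ARITHMETIC binders
  (`d ≡ 1 (mod 4)`; one printed disjunct per prime; `d > 0 ∨ Δ < 0`).
* `routeA_placewise_oddTrace` — the same on the `a_q`-ODD class: binders only at the primes of `d`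
  (`q` good, `a_q` odd) and at the bad primes not dividing `d` (one disjunct each).
* `routeA_placewise_oddTrace_rank_zero` — rank-`0` bases: no Cassels–Tate, no finiteness input.
* `routeA_placewise_oddTrace_bsdp_iff` — hand-over form `BSD(E^{(d)}, 2) ⟺ ord₂ #Ш_an(E^{(d)}) = 0`.

WHY THIS IS NOT IN PRINT AS SUCH: as for `TransportA`. The `Sel₂(E) = 0` conclusions are Mazur–Rubin
Prop. 4.2 / Boxer–Diao Thm 1.1 territory (no novelty); the rank-ONE base case is the assembled half
⟨R⟩ of T4-PROOF Thm B′; the place-wise packaging is the cell's.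

References: Mazur–Rubin, Invent. Math. 181 (2010) Lemma 2.10, Def. 2.3, Prop. 3.3 (proof, first
display), Cor. 3.4 (ii), Prop. 4.2 [MazurRubin2010]; Marcus, *Number Fields*, Ch. 3 Thm. 25
[Marcus2018]; Silverman *AEC* VII.3.1(b) [SilvermanAEC2009]; Miller 2011 Def. 1.1 [Miller2011LMS].
-/

noncomputable section

open scoped Classical AddSubgroup

open NumberField WeierstrassCurve Literature.NumberTheory.EllipticCurves
  Literature.NumberTheory.EllipticCurves.Rank1Residual
  Literature.NumberTheory.QuadraticFields
  Summit.BirchSwinnertonDyer.Rank1Residual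

namespace Summit.BirchSwinnertonDyer.Uniform.U2

/-! ## §1 The numbered corollary is the special case -/

section Consistency

/-- **Cor. 3.4 (ii) with Prop. 3.3 follows from the place-wise form.** Under Prop. 3.3's splitting
list (additive primes split; even-`ord` multiplicative primes split; `2` splits; `F` real if `Δ > 0`;
odd-`ord` multiplicative primes unramified) and `T = ∅` (`E(ℚ_p)[2] = 0` at every ramified prime),
every place satisfies one of Lemma 2.10 (i)–(v): additive and even-`ord` multiplicative primes (i);
odd-`ord` multiplicative primes (iii); unramified good primes (v); ramified good primes (ii) — they
are odd because `2` splits, hence is unramified (`d_F ≡ 1 (mod 8)`, decomposition law); the real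
place (i) or (iv) according to the sign of `Δ ≠ 0`. Consistency of the two typed named facts;
bookkeeping. [cite: MazurRubin2010, Lemma 2.10, Prop. 3.3 (proof, first display) and Cor. 3.4 (ii)]
[cite: Marcus2018, Ch. 3 Thm. 25] -/
theorem cor34ii_rat_of_d2_eq_of_lemma210_rat (h : MazurRubin2010.d2_eq_of_lemma210_rat) :
    MazurRubin2010.cor34ii_rat := by
  intro W _ d hd hd1 F _ _ hF hx hadd hmev h2 hreal hmodd hT W' _ htw
  refine h W d hd hd1 F hF hx (fun p _ => ?_) ?_ W' htw
  · by_cases hgood : W.HasGoodReductionAtPrime p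
    · by_cases hram : (p : ℤ) ∣ NumberField.discr F
      · -- ramified good prime: `T = ∅` gives `E(ℚ_p)[2] = 0`; `p ≠ 2` since `2` splits
        refine Or.inr (Or.inl ⟨?_, hT p hram⟩)
        rintro rfl
        have h8 : NumberField.discr F % 8 = 1 := (Quadratic.ncard_primesOver_two_eq_two_iff hF).mp h2
        have h2dvd : (2 : ℤ) ∣ NumberField.discr F := by exact_mod_cast hram
        omega
      · exact Or.inr (Or.inr (Or.inr ⟨hgood, hram⟩))
    · by_cases hmult : W.HasMultiplicativeReductionAtPrime p
      · rcases Int.even_or_odd (padicValRat p W.Δ) with he | ho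
        · exact Or.inl (hmev p hmult he)
        · exact Or.inr (Or.inr (Or.inl ⟨hmult, hmodd p hmult ho, ho⟩))
      · exact Or.inl (hadd p hgood hmult)
  · have hΔ : W.Δ ≠ 0 := by rw [← coe_Δ']; exact W.Δ'.ne_zero
    rcases lt_or_gt_of_ne hΔ with hneg | hpos
    · exact Or.inr hneg
    · exact Or.inl (hreal hpos)

end Consistency

/-! ## §2 Route A under the place-wise criteria, arithmetic binders -/

section Placewise

variable (W : WeierstrassCurve ℚ) [W.IsElliptic]

omit [W.IsElliptic] in
/-- From the place-wise ARITHMETIC binders on `(E, d)` (`d ≡ 1 (mod 4)` square-free, `≠ 1`) to the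
place-wise binders of `d2_eq_of_lemma210_rat` for ANY quadratic `F ∋ √d` (decomposition law,
tree-proved; `d_F = d`). Bookkeeping. [cite: Marcus2018, Ch. 3 Thm. 25] -/
theorem mr_placewise_binders_of_arith {d : ℤ} (hd : Squarefree d) (hd1 : d ≠ 1) (hd4 : d % 4 = 1)
    (F : Type) [Field F] [NumberField F] (hF : Module.finrank ℚ F = 2) (hx : ∃ x : F, x ^ 2 = (d : F))
    (hloc : ∀ (p : ℕ) [Fact p.Prime],
      ((p = 2 ∧ d % 8 = 1) ∨ (p ≠ 2 ∧ jacobiSym d p = 1)) ∨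
      (p ≠ 2 ∧ ∀ Q : (W.baseChange ℚ_[p]).toAffine.Point, 2 • Q = 0 → Q = 0) ∨
      (W.HasMultiplicativeReductionAtPrime p ∧ ¬ (p : ℤ) ∣ d ∧ Odd (padicValRat p W.Δ)) ∨
      (W.HasGoodReductionAtPrime p ∧ ¬ (p : ℤ) ∣ d))
    (hreal : 0 < d ∨ W.Δ < 0) :
    (∀ (p : ℕ) [Fact p.Prime],
      ((Ideal.span {(p : ℤ)}).primesOver (𝓞 F)).ncard = 2 ∨
      (p ≠ 2 ∧ ∀ Q : (W.baseChange ℚ_[p]).toAffine.Point, 2 • Q = 0 → Q = 0) ∨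
      (W.HasMultiplicativeReductionAtPrime p ∧ ¬ (p : ℤ) ∣ NumberField.discr F ∧
        Odd (padicValRat p W.Δ)) ∨
      (W.HasGoodReductionAtPrime p ∧ ¬ (p : ℤ) ∣ NumberField.discr F)) ∧
    (NumberField.IsTotallyReal F ∨ W.Δ < 0) := by
  have hdF : NumberField.discr F = d := discr_eq_of_sq_eq hF hd hd1 hd4 hx
  refine ⟨fun p hp => ?_, ?_⟩
  · rcases hloc p with (⟨rfl, h8⟩ | ⟨hp2, hj⟩) | h | ⟨hm, hnd, ho⟩ | ⟨hg, hnd⟩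
    · exact Or.inl ((Quadratic.ncard_primesOver_two_eq_two_iff hF).mpr (by rw [hdF]; exact h8))
    · exact Or.inl ((Quadratic.ncard_primesOver_eq_two_iff_jacobiSym hF hp.out hp2).mpr
        (by rw [hdF]; exact hj))
    · exact Or.inr (Or.inl h)
    · exact Or.inr (Or.inr (Or.inl ⟨hm, by rw [hdF]; exact hnd, ho⟩))
    · exact Or.inr (Or.inr (Or.inr ⟨hg, by rw [hdF]; exact hnd⟩))
  · rcases hreal with hpos | hneg
    · left
      have hpos' : 0 < NumberField.discr F := by rw [hdF]; exact hpos
      exact NumberField.nrComplexPlaces_eq_zero_iff.mp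
        (Quadratic.nrRealPlaces_eq_two_and_nrComplexPlaces_eq_zero hF hpos').2
    · exact Or.inr hneg

/-- **ROUTE A, PLACE-WISE (Mazur–Rubin Lemma 2.10 at every place).** Let `E/ℚ` (model `W`) have
`E(ℚ)[2] = 0`, `Ш(E/ℚ)[2] = 0`, `rank E(ℚ) ≤ 1`; let `d ≡ 1 (mod 4)` be square-free, `d ≠ 1`, and
suppose that at EVERY prime `p` one of the printed disjuncts holds, in arithmetic form: (i) `p` splits
in `ℚ(√d)` (`p = 2 ∧ d ≡ 1 (8)`, or `p` odd with `jacobiSym d p = 1`); (ii) `p` odd and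
`E(ℚ_p)[2] = 0`; (iii) `E` multiplicative at `p`, `p ∤ d`, `ord_p(Δ_E)` odd; (v) `E` good at `p`,
`p ∤ d` — and at the real place: `d > 0` or `Δ_E < 0`. If `Ш(E^{(d)}/ℚ)[2^∞]` is finite then, granting
the place-wise Mazur–Rubin fact (`hMR`) and Cassels–Tate (`hCT`): `rank E^{(d)}(ℚ) = rank E(ℚ)` and
`Ш(E^{(d)}/ℚ)[2^∞] = 0`. (At a good prime `p ∤ 2d` disjunct (v) always holds, so the binder only
bites at the bad primes and at the primes of `d`.)
[cite: MazurRubin2010, Lemma 2.10 (i)–(v) with Def. 2.3 and the proof of Prop. 3.3 (T = ∅)]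
[cite: Marcus2018, Ch. 3 Thm. 25] -/
theorem routeA_placewise (hMR : MazurRubin2010.d2_eq_of_lemma210_rat)
    (hCT : exists_casselsTate_pairing (K := ℚ))
    {d : ℤ} (hd : Squarefree d) (hd1 : d ≠ 1) (hd4 : d % 4 = 1)
    (hloc : ∀ (p : ℕ) [Fact p.Prime],
      ((p = 2 ∧ d % 8 = 1) ∨ (p ≠ 2 ∧ jacobiSym d p = 1)) ∨
      (p ≠ 2 ∧ ∀ Q : (W.baseChange ℚ_[p]).toAffine.Point, 2 • Q = 0 → Q = 0) ∨
      (W.HasMultiplicativeReductionAtPrime p ∧ ¬ (p : ℤ) ∣ d ∧ Odd (padicValRat p W.Δ)) ∨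
      (W.HasGoodReductionAtPrime p ∧ ¬ (p : ℤ) ∣ d))
    (hreal : 0 < d ∨ W.Δ < 0)
    (hW2 : W.toAffine.Point[(2 : ℤ)] = ⊥) (hWsha : (W.sha)[(2 : ℤ)] = ⊥) (hWr : W.mordellWeilRank ≤ 1)
    (W' : WeierstrassCurve ℚ) [W'.IsElliptic]
    (htw : ∃ C : VariableChange ℚ, C • W' = W.quadraticTwist (d : ℚ))
    (hfin : Finite (AddCommGroup.primaryComponent W'.sha 2)) :
    W'.mordellWeilRank = W.mordellWeilRank ∧ AddCommGroup.primaryComponent W'.sha 2 = ⊥ := by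
  obtain ⟨F, _, _, hF, hx, -⟩ := exists_quadraticField_of_squarefree hd hd1
  obtain ⟨hloc', hreal'⟩ := mr_placewise_binders_of_arith W hd hd1 hd4 F hF hx hloc hreal
  have hctrl : Nat.card (W'.selmerGroup 2) = Nat.card (W.selmerGroup 2) :=
    hMR W d hd hd1 F hF hx hloc' hreal' W' htw
  have hd0 : (d : ℚ) ≠ 0 := by exact_mod_cast hd.ne_zero
  have hV2 : W'.toAffine.Point[(2 : ℤ)] = ⊥ := torsionBy_two_eq_bot_of_twist W hd0 W' htw hW2
  exact mordellWeilRank_eq_and_sha_two_eq_bot_of_card_selmerGroup_eq W' W hCT hV2 hW2 hWsha hWr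
    hfin hctrl

end Placewise

/-! ## §3 Route A under the place-wise criteria, on the `a_q`-odd class -/

section PlacewiseOddTrace

variable (W : WeierstrassCurve ℚ) [W.IsElliptic] [W.IsGloballyMinimal]

/-- **The place-wise binders from the `a_q`-odd class condition** (bookkeeping). For `W` globally
minimal and `d` odd: if every prime `q ∣ d` has `q ∤ Δ_min` and `a_q` odd (disjunct (ii) there, by
`forall_two_nsmul_eq_zero_iff_odd_frobeniusTrace`), and every BAD prime `p ∤ d` carries one of the
disjuncts (i) split / (ii) `p` odd with `E(ℚ_p)[2] = 0` / (iii) multiplicative with `ord_p Δ` odd, then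
every prime carries a disjunct — the good primes `p ∤ d` carry (v).
[cite: MazurRubin2010, Lemma 2.10 (i)–(v)] [cite: SilvermanAEC2009, Prop. VII.3.1(b)] -/
theorem mr_placewise_loc_of_oddTrace {d : ℤ} (hd2 : ¬ (2 : ℤ) ∣ d)
    (hS : ∀ (q : ℕ), q.Prime → (q : ℤ) ∣ d →
      ¬ (q : ℤ) ∣ minimalDiscriminantInt W ∧ Odd (W.frobeniusTrace q))
    (hbad : ∀ (p : ℕ) [Fact p.Prime], (p : ℤ) ∣ minimalDiscriminantInt W →
      ((p = 2 ∧ d % 8 = 1) ∨ (p ≠ 2 ∧ jacobiSym d p = 1)) ∨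
      (p ≠ 2 ∧ ∀ Q : (W.baseChange ℚ_[p]).toAffine.Point, 2 • Q = 0 → Q = 0) ∨
      (W.HasMultiplicativeReductionAtPrime p ∧ Odd (padicValRat p W.Δ))) :
    ∀ (p : ℕ) [Fact p.Prime],
      ((p = 2 ∧ d % 8 = 1) ∨ (p ≠ 2 ∧ jacobiSym d p = 1)) ∨
      (p ≠ 2 ∧ ∀ Q : (W.baseChange ℚ_[p]).toAffine.Point, 2 • Q = 0 → Q = 0) ∨
      (W.HasMultiplicativeReductionAtPrime p ∧ ¬ (p : ℤ) ∣ d ∧ Odd (padicValRat p W.Δ)) ∨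
      (W.HasGoodReductionAtPrime p ∧ ¬ (p : ℤ) ∣ d) := by
  intro p hp
  by_cases hpd : (p : ℤ) ∣ d
  · -- a prime of `d`: good, odd, `a_p` odd ⇒ (ii)
    exact Or.inr (Or.inl ((mr_unramified_and_T_empty_of_oddTrace W hd2 hS).2 p hpd |> fun h =>
      ⟨by rintro rfl; exact hd2 (by exact_mod_cast hpd), h⟩))
  · by_cases hΔ : (p : ℤ) ∣ minimalDiscriminantInt W
    · rcases hbad p hΔ with h | h | ⟨hm, ho⟩
      · exact Or.inl h
      · exact Or.inr (Or.inl h)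
      · exact Or.inr (Or.inr (Or.inl ⟨hm, hpd, ho⟩))
    · exact Or.inr (Or.inr (Or.inr ⟨hasGoodReductionAtPrime_of_not_dvd W p hΔ, hpd⟩))

/-- **ROUTE A, PLACE-WISE, ON THE `a_q`-ODD CLASS.** Let `E/ℚ` be given by a globally minimal model
`W` with `E(ℚ)[2] = 0`, `Ш(E/ℚ)[2] = 0`, `rank E(ℚ) ≤ 1`. Let `d ≡ 1 (mod 4)` be square-free, `d ≠ 1`
(so every prime of `d` is odd and `2` is unramified in `ℚ(√d)`), such that: every prime `q ∣ d` is a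
good prime (`q ∤ Δ_min`) with `a_q(E)` ODD; every BAD prime `p` (necessarily `p ∤ d`) satisfies ONE
of — (i) `p` splits in `ℚ(√d)` (`p = 2 ∧ d ≡ 1 (8)`, or `p` odd with `jacobiSym d p = 1`), (ii) `p`
odd and `E(ℚ_p)[2] = 0`, (iii) multiplicative with `ord_p(Δ)` odd; and `d > 0` or `Δ < 0`. If
`Ш(E^{(d)}/ℚ)[2^∞]` is finite then, granting the place-wise Mazur–Rubin fact (`hMR`) and
Cassels–Tate (`hCT`): `rank E^{(d)}(ℚ) = rank E(ℚ)` and `Ш(E^{(d)}/ℚ)[2^∞] = 0`. In particular a base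
with GOOD reduction at `2` needs nothing at `2` (`d ≡ 5 (mod 8)` allowed).
[cite: MazurRubin2010, Lemma 2.10 (i)–(v) with Def. 2.3 and the proof of Prop. 3.3 (T = ∅)]
[cite: SilvermanAEC2009, Prop. VII.3.1(b)] [cite: Marcus2018, Ch. 3 Thm. 25] -/
theorem routeA_placewise_oddTrace (hMR : MazurRubin2010.d2_eq_of_lemma210_rat)
    (hCT : exists_casselsTate_pairing (K := ℚ))
    {d : ℤ} (hd : Squarefree d) (hd1 : d ≠ 1) (hd4 : d % 4 = 1)
    -- the `a_q`-odd class condition at the primes of `d`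
    (hS : ∀ (q : ℕ), q.Prime → (q : ℤ) ∣ d →
      ¬ (q : ℤ) ∣ minimalDiscriminantInt W ∧ Odd (W.frobeniusTrace q))
    -- one printed disjunct at each bad prime
    (hbad : ∀ (p : ℕ) [Fact p.Prime], (p : ℤ) ∣ minimalDiscriminantInt W →
      ((p = 2 ∧ d % 8 = 1) ∨ (p ≠ 2 ∧ jacobiSym d p = 1)) ∨
      (p ≠ 2 ∧ ∀ Q : (W.baseChange ℚ_[p]).toAffine.Point, 2 • Q = 0 → Q = 0) ∨
      (W.HasMultiplicativeReductionAtPrime p ∧ Odd (padicValRat p W.Δ)))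
    (hreal : 0 < d ∨ W.Δ < 0)
    -- base data
    (hW2 : W.toAffine.Point[(2 : ℤ)] = ⊥) (hWsha : (W.sha)[(2 : ℤ)] = ⊥) (hWr : W.mordellWeilRank ≤ 1)
    -- the twist and its finiteness input
    (W' : WeierstrassCurve ℚ) [W'.IsElliptic]
    (htw : ∃ C : VariableChange ℚ, C • W' = W.quadraticTwist (d : ℚ))
    (hfin : Finite (AddCommGroup.primaryComponent W'.sha 2)) :
    W'.mordellWeilRank = W.mordellWeilRank ∧ AddCommGroup.primaryComponent W'.sha 2 = ⊥ := by
  have hd2 : ¬ (2 : ℤ) ∣ d := by omega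
  exact routeA_placewise W hMR hCT hd hd1 hd4 (mr_placewise_loc_of_oddTrace W hd2 hS hbad) hreal hW2
    hWsha hWr W' htw hfin

/-- **ROUTE A, PLACE-WISE, ON THE `a_q`-ODD CLASS — RANK-ZERO BASES: no Cassels–Tate, no finiteness
input.** Same class binders; if `E(ℚ)[2] = 0`, `Ш(E/ℚ)[2] = 0` and `rank E(ℚ) = 0` then
`rank E^{(d)}(ℚ) = 0`, `E^{(d)}(ℚ)[2] = 0` and `Ш(E^{(d)}/ℚ)[2^∞] = 0` outright (`Sel₂(E^{(d)}) = 0`; the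
printed cases are Mazur–Rubin Prop. 4.2 and Boxer–Diao Thm 1.1).
[cite: MazurRubin2010, Lemma 2.10 (i)–(v) with Def. 2.3 and the proof of Prop. 3.3 (T = ∅), and Prop. 4.2]
[cite: SilvermanAEC2009, Prop. VII.3.1(b)] -/
theorem routeA_placewise_oddTrace_rank_zero (hMR : MazurRubin2010.d2_eq_of_lemma210_rat)
    {d : ℤ} (hd : Squarefree d) (hd1 : d ≠ 1) (hd4 : d % 4 = 1)
    (hS : ∀ (q : ℕ), q.Prime → (q : ℤ) ∣ d →
      ¬ (q : ℤ) ∣ minimalDiscriminantInt W ∧ Odd (W.frobeniusTrace q))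
    (hbad : ∀ (p : ℕ) [Fact p.Prime], (p : ℤ) ∣ minimalDiscriminantInt W →
      ((p = 2 ∧ d % 8 = 1) ∨ (p ≠ 2 ∧ jacobiSym d p = 1)) ∨
      (p ≠ 2 ∧ ∀ Q : (W.baseChange ℚ_[p]).toAffine.Point, 2 • Q = 0 → Q = 0) ∨
      (W.HasMultiplicativeReductionAtPrime p ∧ Odd (padicValRat p W.Δ)))
    (hreal : 0 < d ∨ W.Δ < 0)
    (hW2 : W.toAffine.Point[(2 : ℤ)] = ⊥) (hWsha : (W.sha)[(2 : ℤ)] = ⊥) (hWr : W.mordellWeilRank = 0)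
    (W' : WeierstrassCurve ℚ) [W'.IsElliptic]
    (htw : ∃ C : VariableChange ℚ, C • W' = W.quadraticTwist (d : ℚ)) :
    W'.mordellWeilRank = 0 ∧ W'.toAffine.Point[(2 : ℤ)] = ⊥ ∧
      AddCommGroup.primaryComponent W'.sha 2 = ⊥ := by
  have hd2 : ¬ (2 : ℤ) ∣ d := by omega
  obtain ⟨F, _, _, hF, hx, -⟩ := exists_quadraticField_of_squarefree hd hd1
  obtain ⟨hloc', hreal'⟩ := mr_placewise_binders_of_arith W hd hd1 hd4 F hF hx
    (mr_placewise_loc_of_oddTrace W hd2 hS hbad) hreal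
  have hctrl : Nat.card (W'.selmerGroup 2) = Nat.card (W.selmerGroup 2) :=
    hMR W d hd hd1 F hF hx hloc' hreal' W' htw
  have hW : Nat.card (W.selmerGroup 2) = 1 := by
    rw [natCard_selmerGroup_two_eq W, hWr, hW2, hWsha, pow_zero, AddSubgroup.card_bot,
      AddSubgroup.card_bot, mul_one, mul_one]
  exact rank_eq_zero_and_sha_two_eq_bot_of_card_selmerGroup_two_eq_one W' (hctrl.trans hW)

/-- **ROUTE A, PLACE-WISE, ON THE `a_q`-ODD CLASS — hand-over form.** Same class binders, finiteness
supplied as `r_an(E^{(d)}) ≤ 1` (+ GZK `hGZK`): `rank E^{(d)} = rank E = r_an(E^{(d)})`,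
`Ш(E^{(d)})[2^∞] = 0`, and `BSD(E^{(d)}, 2) ⟺ ord₂ #Ш_an(E^{(d)}) = 0` (Miller's `BSDp W' 2`; `shaAn W'` is
`#Ш_an` for a globally minimal `W'`).
[cite: MazurRubin2010, Lemma 2.10 (i)–(v) with Def. 2.3 and the proof of Prop. 3.3 (T = ∅)]
[cite: Miller2011LMS, Def. 1.1] [cite: SilvermanAEC2009, Prop. VII.3.1(b)] -/
theorem routeA_placewise_oddTrace_bsdp_iff (hMR : MazurRubin2010.d2_eq_of_lemma210_rat)
    (hCT : exists_casselsTate_pairing (K := ℚ)) (hGZK : rank_eq_analyticRank_of_analyticRank_le_one)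
    {d : ℤ} (hd : Squarefree d) (hd1 : d ≠ 1) (hd4 : d % 4 = 1)
    (hS : ∀ (q : ℕ), q.Prime → (q : ℤ) ∣ d →
      ¬ (q : ℤ) ∣ minimalDiscriminantInt W ∧ Odd (W.frobeniusTrace q))
    (hbad : ∀ (p : ℕ) [Fact p.Prime], (p : ℤ) ∣ minimalDiscriminantInt W →
      ((p = 2 ∧ d % 8 = 1) ∨ (p ≠ 2 ∧ jacobiSym d p = 1)) ∨
      (p ≠ 2 ∧ ∀ Q : (W.baseChange ℚ_[p]).toAffine.Point, 2 • Q = 0 → Q = 0) ∨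
      (W.HasMultiplicativeReductionAtPrime p ∧ Odd (padicValRat p W.Δ)))
    (hreal : 0 < d ∨ W.Δ < 0)
    (hW2 : W.toAffine.Point[(2 : ℤ)] = ⊥) (hWsha : (W.sha)[(2 : ℤ)] = ⊥) (hWr : W.mordellWeilRank ≤ 1)
    (W' : WeierstrassCurve ℚ) [W'.IsElliptic]
    (htw : ∃ C : VariableChange ℚ, C • W' = W.quadraticTwist (d : ℚ)) (hr : W'.analyticRank ≤ 1) :
    W'.mordellWeilRank = W.mordellWeilRank ∧ W'.analyticRank = W.mordellWeilRank ∧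
      AddCommGroup.primaryComponent W'.sha 2 = ⊥ ∧
      (BSDp W' 2 ↔ ∃ q : ℚ, shaAn W' = (q : ℂ) ∧ padicValRat 2 q = 0) := by
  have hfin := finite_primaryComponent_sha_of_analyticRank_le_one hGZK W' hr
  obtain ⟨hrank, hsha⟩ := routeA_placewise_oddTrace W hMR hCT hd hd1 hd4 hS hbad hreal hW2 hWsha hWr
    W' htw hfin
  have hra : W'.mordellWeilRank = W'.analyticRank := (hGZK W' hr).1
  refine ⟨hrank, by omega, hsha, ?_⟩
  rw [bsdp_iff]
  constructor
  · rintro ⟨-, -, q, hq, hv⟩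
    refine ⟨q, hq, ?_⟩
    rw [hv, hsha, AddSubgroup.card_bot]
    simp
  · rintro ⟨q, hq, hv⟩
    refine ⟨hra, hfin, q, hq, ?_⟩
    rw [hv, hsha, AddSubgroup.card_bot]
    simp

end PlacewiseOddTrace

end Summit.BirchSwinnertonDyer.Uniform.U2

end
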